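import Literature.MathematicalPhysics.QuantumFieldTheory.Balaban1983to89.B1Eq324BenfattoSect5CondToFree
import Literature.MathematicalPhysics.QuantumFieldTheory.Balaban1983to89.B1Eq324BenfattoKernelAppendixD
import HarnessLib

/-!
# `Balaban1983to89.B1Eq324BenfattoKernelCondToFree` — [BenfattoEtAl1978] §5 p. 153 / (5.31) p. 158, «(error)», FOR GENERAL
# GAUSSIAN KERNEL FIELDS: the joint truncated expectations of monomial clusters under two SHIFTED kernel fields
# `𝒩(0,K₁)∘(u₁+·)⁻¹`, `𝒩(0,K₀)∘(u₀+·)⁻¹` with leg-wise `ε`-close centres and propagators are `2^{|Λ|}2^{2^{|Λ|}}|Λ|R^{|Λ|}ε`-close;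
# the instances «conditioned field of a kernel (covariance conditioned on `C`, centre conditioned on `C′`) versus the centred field
# of the kernel»; and the a-priori size of the moments of monomials under a shifted kernel field — PROVED

statement-level skeleton of published theorems with citation tags; proofs where landed; nothing here is a claim about the
Yang–Mills mass gap

WHY THIS MODULE (cell `pub-ymgap`, seat `dag-n08-b` gen 10; node N08 [Balaban1985UV3]; the [BenfattoEtAl1978] source chain behind
the (α)-row `h324c` of [Balaban1985UV3] (24)/(58) via [Balaban1984UV1] (3.24)).  The sketch of §5 (p. 153, verbatim, desk render
`lit-balaban/inprint/lit-balaban-type-B10/benfatto1978-cmp59/bcg_p153.png` via the sibling `…Sect5CondToFree`): *"where 𝓔^T_z̄ denotes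
the truncated expectation with respect to the conditioned measure. Such expectations are polynomials in the z̄ and differ very little
from the ones we want (i.e. the unconditional ones) if Δ₁, …, Δ_p are far from the region ∪_□(∂□) because the covariance of the z_Δ's
decays exponentially and, far from ∪_□(∂□), coincides with the unconditional covariance."*; in the proof this is the «(error)» of
(5.31) p. 158.  The tree holds this comparison for print's nearest-neighbour free field only
(`…Sect5CondToFree.abs_ursellOf_condField_sub_P0_le`: `condField d α β Γ z̄` versus `P̂₀ = P0 d α β`), although its two halves are
kernel-generic already: the WEIGHT-PERTURBATION half (`…Sect5CondToFree.abs_ursellOf_dmoment_sub_le`: two systems of diagram block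
weights, bounded by `R` and `ε`-close block by block, have `2^{|Λ|}2^{2^{|Λ|}}|Λ|R^{|Λ|}ε`-close truncated diagram moments) and the
MEASURE half (Wick's theorem with a source for the shifted field of ANY positive-semidefinite kernel on ANY index set, read in the
diagram vocabulary: `…KernelAppendixD.dmoment_eq_integral_prod_shift`, seat dag-n08-c).  This file composes them.
It is the (5.31)-row companion of `…KernelAppendixD` (App. D for a shifted kernel field) in the kernel-generic LIBRARY layer that the
sibling seats' census (`N08-BASICLEMMA-KERNEL-CENSUS.md` §6) records; after the temperature-zero (5.13) substitute
`…KernelComparisonBounded` (seat dag-n08-d: on bounded-fluctuation supports the conditioned field of an exponentially-decaying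
precision is two-sidedly comparable with the product of the PLAIN Dirichlet box Gaussians `N(u_{Γ₁}(ξ)|_□, (A|_□)⁻¹)`), the per-box
Gaussian whose cumulants a class edition of (5.23)–(5.31) compares with the free ones has covariance conditioned on the COMPLEMENT OF
THE BOX and centre conditioned on the CORRIDORS — two different conditioning sets; §2 is stated for that shape (`C` for the
covariance, `C′` for the centre), print's architecture being `C = C′`.

DICTIONARY.  `𝓔^T(z^{A_j}, j ∈ J)` ↦ `LatticeModels.ursellOf (P ↦ ∫ Π_{l ∈ legs own P} z(x_l) dμ) (allV J)` for monomial clusters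
with legs `Λ` (`own : Λ → J`, positions `x : Λ → S`); a shifted kernel field ↦ `(gaussianFieldOfKernel K).map (ζ ↦ u + ζ)`; the
conditioned field of a kernel on the lattice `Q₀ = Site d` ↦ `(gaussianFieldOfKernel (condCov K C)).map (ζ ↦ condMean K C′ z̄ + ζ)`
(`…KernelCondField`'s `P̄^K_{C,z̄}` when `C′ = C`); «2-point functions» ↦ `K(x_a,x_b)`; centre insertions ↦ `u(x_l)`.

WHAT IS PROVED (theorems only; no definition, no instance, no notation, no named fact, no `sorry`; axioms standard).
* §1 (any index type `S`, psd kernels `K₁, K₀`, centres `u₁, u₀`) ★★ **`abs_ursellOf_shift_sub_shift_le`** — if on the legs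
  `|u₁|, |u₀|, |K₁|, |K₀| ≤ R` (`R ≥ 1`), `|u₁(x_l) − u₀(x_l)| ≤ ε` and `|K₁(x_a,x_b) − K₀(x_a,x_b)| ≤ ε`, then
  `|𝓔^T_{K₁,u₁}(z^{A_j}, j∈J) − 𝓔^T_{K₀,u₀}(z^{A_j}, j∈J)| ≤ 2^{|Λ|}·2^{2^{|Λ|}}·(|Λ|·R^{|Λ|}·ε)`;
  ★ **`abs_ursellOf_shift_sub_kernel_le`** — the same against the CENTRED field `𝒩(0,K₀)` (`|u₁(x_l)| ≤ ε`);
  **`abs_integral_prod_shift_le`** — a-priori moments `|∫ Π_{l∈s} z(x_l) d[𝒩(0,K)∘(u+·)⁻¹]| ≤ 2^{2^{|s|}}·K₀^{|s|}` from `|u(x_l)|,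
  |K(x_a,x_b)| ≤ K₀` (`K₀ ≥ 1`) — the kernel twin of `…Sect5CondToFree.abs_integral_prod_eval_condField_le` («point 2)»).
* §2 (the lattice `Q₀`, `K` psd with `K_CC` invertible, a second conditioning set `C′` for the centre)
  ★★ **`abs_ursellOf_condKernel_sub_kernel_le`** — `|𝓔^T_{C^C, u_{C′}(z̄)}(…) − 𝓔^T_{K,0}(…)| ≤ 2^{|Λ|}·2^{2^{|Λ|}}·(|Λ|·R^{|Λ|}·ε)` from
  `|u_{C′}(z̄)(x_l)| ≤ ε`, `|C^C(x_a,x_b) − K(x_a,x_b)| ≤ ε` and the a-priori `R` (covariance conditioned on `C`, centre on `C′`);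
  **`abs_ursellOf_condFieldK_sub_kernel_le`** — the case `C′ = C` (`P̄^K_{C,z̄}` versus `𝒩(0,K)`: the exact kernel twin of
  `…Sect5CondToFree.abs_ursellOf_condField_sub_P0_le`); **`abs_integral_prod_condKernel_le`** — the a-priori moments under the
  two-set conditioned field.
SUPPLIERS OF `ε` AND `R` BY NAME (not restated): for the precision class (`K x y = [x,y∈Λ]·(A⁻¹)_{xy}`, `A` symmetric, `γ`-coercive,
Combes–Thomas row defect `J < γ`): `R` — (C.6)/(C.2)-class `…KernelOfPrecision.abs_kernel_le_exp` / `abs_condCov_kernel_le_exp`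
(uniform in `C`) and (C.8)-class `abs_condMean_kernel_le_profile`; `ε` for the covariance — (C.7)-class
`…KernelOfPrecision.abs_kernel_sub_condCov_le_exp` (matrix face `…ClassAppendixC.abs_cov_sub_schur_le_exp`), decaying in the distance of
the legs from `C`; `ε` for the centre — `abs_condMean_kernel_le_profile` with the corridor geometry, and the quantitative centre
locality `…ClassCentreLocality.abs_regression_sub_le_exp`.  At `C = Q₀∖□` (inside a finite `Λ`) the covariance `C^C|_□` is the
Dirichlet box covariance `(A|_□)⁻¹` (`…ClassAppendixC.schur_eq_inv_submatrix_compl`).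

HONEST SCOPE / NOT HERE.  Kernel-generic composition of two landed tree theorems; [folklore] mathematics at [BenfattoEtAl1978]'s
locus; the diagram count is r14's crude `card_diags_le`, not print's constants; the corridor GEOMETRY turning `ε` into
`e^{−δ·dist(legs, C)}` and the χ-carrying version are the boxes line's / the (uncommissioned) §5-side port's; nothing of the §5 chain
is ported here; the class HYPOTHESES of a generalised Basic Lemma and that lemma are NOT stated or proved; nothing of
[Balaban1985UV3] (24)/(41)/(47)/(58) is asserted; count-neutral for N08; nothing about d = 4, the continuum, OS axioms, a mass gap
or the Clay problem.
-/

open Finset MeasureTheory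
open scoped BigOperators

namespace Literature.MathematicalPhysics.QuantumFieldTheory.Balaban1983to89.B1Eq324BenfattoKernelCondToFree

open _root_.MeasureTheory _root_.ProbabilityTheory
open Literature.Probability.LatticeModels (IsSetPartition setPartitions mem_setPartitions ursellOf ursellOf_eq)
open Literature.Probability.LatticeModels.LegDiagram (legs mem_legs dmoment)
open Literature.MathematicalPhysics.QuantumFieldTheory
open Literature.MathematicalPhysics.QuantumFieldTheory.Balaban1983to89.HiggsFluctMeasureWickPairings
  (pairVal pairVal_pair pairVal_of_card_ne_two)
open Literature.MathematicalPhysics.QuantumFieldTheory.Balaban1983to89.B1Eq323ConnectedGraphBound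
  (allV some_mem_allV none_not_mem_allV card_le_of_isSetPartition)
open Literature.MathematicalPhysics.QuantumFieldTheory.Balaban1983to89.B1Eq324BenfattoSect5CondToFree
  (abs_ursellOf_dmoment_sub_le)
open Literature.MathematicalPhysics.QuantumFieldTheory.Balaban1983to89.B1Eq324BenfattoAppendixDWick
  (integral_prod_shift_eq_sum_setPartitions)
open Literature.MathematicalPhysics.QuantumFieldTheory.Balaban1983to89.B1Eq324BenfattoKernelAppendixD
  (dmoment_eq_integral_prod_shift)
open Literature.MathematicalPhysics.QuantumFieldTheory.Balaban1983to89.B1Eq324BenfattoKernelRegression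
  (isPosSemidefKernel_condCov)
open Literature.MathematicalPhysics.QuantumFieldTheory.Balaban1983to89.B1Eq324BenfattoLemma

/-! ## §1  Two shifted Gaussian kernel fields on any index set -/

section TwoShifts

variable {S : Type} [DecidableEq S] {K₁ K₀ : S → S → ℝ}
variable {J : Type} [Fintype J] [DecidableEq J] {Λ : Type} [Fintype Λ] [LinearOrder Λ] (own : Λ → J)

/-- Locality of the Ursell function: it reads the moment function on the subsets of `V` only (private copy, as in the sibling
files; public twin `UrsellMomentDerivative.ursellOf_congr_of_subset`). [folklore] -/
private theorem ursellOf_congr_subset {γ : Type*} [DecidableEq γ] {m m' : Finset γ → ℝ} {V : Finset γ}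
    (h : ∀ P ⊆ V, m P = m' P) : ursellOf m V = ursellOf m' V := by
  induction V using Finset.strongInduction with
  | H V ih =>
    rw [ursellOf_eq, ursellOf_eq, h V Subset.rfl]
    congr 1
    refine sum_congr rfl fun π hπ => prod_congr rfl fun P hP => ?_
    obtain ⟨hne, hπ'⟩ := mem_erase.1 hπ
    have hsp := mem_setPartitions.1 hπ'
    have hPV : P ⊂ V := hsp.ssubset_of_ne_singleton hne hP
    exact ih P hPV fun Q hQ => h Q (hQ.trans hPV.subset)

omit [DecidableEq S] [Fintype J] [DecidableEq J] [Fintype Λ] in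
/-- The block weights of two shifted kernel fields (sources `u_i(x_l)`, propagators `K_i(x_a,x_b)`, nothing larger): their common
sup `R` and their distance `ε`, from leg-wise bounds. [folklore] -/
private theorem shift_weight_bounds (u₁ u₀ : S → ℝ) (x : Λ → S) {R ε : ℝ} (hR0 : 0 ≤ R) (hε0 : 0 ≤ ε)
    (hu₁R : ∀ l, |u₁ (x l)| ≤ R) (hu₀R : ∀ l, |u₀ (x l)| ≤ R)
    (hK₁R : ∀ a b, |K₁ (x a) (x b)| ≤ R) (hK₀R : ∀ a b, |K₀ (x a) (x b)| ≤ R)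
    (huε : ∀ l, |u₁ (x l) - u₀ (x l)| ≤ ε) (hKε : ∀ a b, |K₁ (x a) (x b) - K₀ (x a) (x b)| ≤ ε) (B : Finset Λ) :
    |(if B.card = 1 then ∏ l ∈ B, u₁ (x l) else pairVal (fun i j => K₁ (x i) (x j)) B)| ≤ R ∧
      |(if B.card = 1 then ∏ l ∈ B, u₀ (x l) else pairVal (fun i j => K₀ (x i) (x j)) B)| ≤ R ∧
      |(if B.card = 1 then ∏ l ∈ B, u₁ (x l) else pairVal (fun i j => K₁ (x i) (x j)) B) -
        (if B.card = 1 then ∏ l ∈ B, u₀ (x l) else pairVal (fun i j => K₀ (x i) (x j)) B)| ≤ ε := by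
  by_cases h1 : B.card = 1
  · obtain ⟨l, rfl⟩ := card_eq_one.1 h1
    simp only [card_singleton, if_true, prod_singleton]
    exact ⟨hu₁R l, hu₀R l, huε l⟩
  · simp only [if_neg h1]
    by_cases h2 : B.card = 2
    · obtain ⟨a, b, hab, rfl⟩ := card_eq_two.1 h2
      rcases lt_or_gt_of_ne hab with h | h
      · rw [pairVal_pair _ h, pairVal_pair _ h]
        exact ⟨hK₁R a b, hK₀R a b, hKε a b⟩
      · rw [pair_comm, pairVal_pair _ h, pairVal_pair _ h]
        exact ⟨hK₁R b a, hK₀R b a, hKε b a⟩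
    · rw [pairVal_of_card_ne_two _ h2, pairVal_of_card_ne_two _ h2, sub_zero, abs_zero]
      exact ⟨hR0, hR0, hε0⟩

/-- **(5.31)'s «(error)» FOR TWO SHIFTED KERNEL FIELDS** — «such expectations … differ very little from the ones we want … because the
covariance … far from ∪_□(∂□), coincides with the unconditional covariance» (p. 153), in kernel-generic form: for positive-semidefinite
kernels `K₁, K₀` on any index set `S`, centres `u₁, u₀`, legs `x : Λ → S` of the monomial clusters `own : Λ → J` (all clusters
present) with the a-priori bound `|u₁(x_l)|, |u₀(x_l)|, |K₁(x_a,x_b)|, |K₀(x_a,x_b)| ≤ R` (`R ≥ 1`) and the closeness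
`|u₁(x_l) − u₀(x_l)| ≤ ε`, `|K₁(x_a,x_b) − K₀(x_a,x_b)| ≤ ε` on the legs,
`|𝓔^T_{𝒩(0,K₁)∘(u₁+·)⁻¹}(z^{A_j}, j∈J) − 𝓔^T_{𝒩(0,K₀)∘(u₀+·)⁻¹}(z^{A_j}, j∈J)| ≤ 2^{|Λ|}·2^{2^{|Λ|}}·(|Λ|·R^{|Λ|}·ε)`
— both sides are the same connected diagrams (`…KernelAppendixD.dmoment_eq_integral_prod_shift`) with `ε`-close block weights
(`…Sect5CondToFree.abs_ursellOf_dmoment_sub_le`). [cite: BenfattoEtAl1978, (5.31) p.158 and p.153] -/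
theorem abs_ursellOf_shift_sub_shift_le [Nonempty J] (hK₁ : IsPosSemidefKernel K₁) (hK₀ : IsPosSemidefKernel K₀)
    (u₁ u₀ : S → ℝ) (x : Λ → S) {R ε : ℝ} (hR : 1 ≤ R) (hε : 0 ≤ ε)
    (hu₁R : ∀ l, |u₁ (x l)| ≤ R) (hu₀R : ∀ l, |u₀ (x l)| ≤ R)
    (hK₁R : ∀ a b, |K₁ (x a) (x b)| ≤ R) (hK₀R : ∀ a b, |K₀ (x a) (x b)| ≤ R)
    (huε : ∀ l, |u₁ (x l) - u₀ (x l)| ≤ ε) (hKε : ∀ a b, |K₁ (x a) (x b) - K₀ (x a) (x b)| ≤ ε) :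
    |ursellOf (fun P : Finset (Option J) => ∫ z, ∏ l ∈ legs own P, z (x l)
          ∂((gaussianFieldOfKernel K₁).map fun (ζ : S → ℝ) (y : S) => u₁ y + ζ y)) (allV J) -
        ursellOf (fun P : Finset (Option J) => ∫ z, ∏ l ∈ legs own P, z (x l)
          ∂((gaussianFieldOfKernel K₀).map fun (ζ : S → ℝ) (y : S) => u₀ y + ζ y)) (allV J)| ≤
      2 ^ Fintype.card Λ * 2 ^ 2 ^ Fintype.card Λ * (Fintype.card Λ * R ^ Fintype.card Λ * ε) := by
  set w₁ : Finset Λ → ℝ := fun B => if B.card = 1 then ∏ l ∈ B, u₁ (x l) else pairVal (fun i j => K₁ (x i) (x j)) B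
    with hw₁
  set w₀ : Finset Λ → ℝ := fun B => if B.card = 1 then ∏ l ∈ B, u₀ (x l) else pairVal (fun i j => K₀ (x i) (x j)) B
    with hw₀
  have h1 : ursellOf (fun P : Finset (Option J) => ∫ z, ∏ l ∈ legs own P, z (x l)
        ∂((gaussianFieldOfKernel K₁).map fun (ζ : S → ℝ) (y : S) => u₁ y + ζ y)) (allV J)
      = ursellOf (dmoment own w₁ (fun _ => 0)) (allV J) :=
    ursellOf_congr_subset fun P hP =>
      (dmoment_eq_integral_prod_shift own hK₁ u₁ x (fun _ => 0) fun h => none_not_mem_allV (hP h)).symm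
  have h0 : ursellOf (fun P : Finset (Option J) => ∫ z, ∏ l ∈ legs own P, z (x l)
        ∂((gaussianFieldOfKernel K₀).map fun (ζ : S → ℝ) (y : S) => u₀ y + ζ y)) (allV J)
      = ursellOf (dmoment own w₀ (fun _ => 0)) (allV J) :=
    ursellOf_congr_subset fun P hP =>
      (dmoment_eq_integral_prod_shift own hK₀ u₀ x (fun _ => 0) fun h => none_not_mem_allV (hP h)).symm
  rw [h1, h0]
  have hWB := fun B =>
    shift_weight_bounds (K₁ := K₁) (K₀ := K₀) u₁ u₀ x (zero_le_one.trans hR) hε hu₁R hu₀R hK₁R hK₀R huε hKε B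
  exact abs_ursellOf_dmoment_sub_le own w₁ w₀ (fun _ => 0) hR hε (fun B => (hWB B).1) (fun B => (hWB B).2.1)
    fun B => (hWB B).2.2

omit [DecidableEq S] in
/-- Shifting by the zero centre does nothing. [folklore] -/
private theorem map_add_zero_eq (μ : Measure (S → ℝ)) :
    (μ.map fun (ζ : S → ℝ) (y : S) => (0 : ℝ) + ζ y) = μ := by
  have h : (fun (ζ : S → ℝ) (y : S) => (0 : ℝ) + ζ y) = id := by
    funext ζ y
    simp
  rw [h, Measure.map_id]

/-- **(5.31)'s «(error)» AGAINST THE CENTRED FIELD** — the form meeting «the unconditional ones» (p. 153): for psd kernels `K₁, K₀`, a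
centre `u₁` with `|u₁(x_l)| ≤ ε` on the legs, `|K₁(x_a,x_b) − K₀(x_a,x_b)| ≤ ε`, and the a-priori `|u₁|, |K₁|, |K₀| ≤ R` (`R ≥ 1`) there,
`|𝓔^T_{𝒩(0,K₁)∘(u₁+·)⁻¹}(z^{A_j}, j∈J) − 𝓔^T_{𝒩(0,K₀)}(z^{A_j}, j∈J)| ≤ 2^{|Λ|}·2^{2^{|Λ|}}·(|Λ|·R^{|Λ|}·ε)`.
[cite: BenfattoEtAl1978, (5.31) p.158 and p.153] -/
theorem abs_ursellOf_shift_sub_kernel_le [Nonempty J] (hK₁ : IsPosSemidefKernel K₁) (hK₀ : IsPosSemidefKernel K₀)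
    (u₁ : S → ℝ) (x : Λ → S) {R ε : ℝ} (hR : 1 ≤ R) (hε : 0 ≤ ε)
    (hu₁R : ∀ l, |u₁ (x l)| ≤ R) (hK₁R : ∀ a b, |K₁ (x a) (x b)| ≤ R) (hK₀R : ∀ a b, |K₀ (x a) (x b)| ≤ R)
    (huε : ∀ l, |u₁ (x l)| ≤ ε) (hKε : ∀ a b, |K₁ (x a) (x b) - K₀ (x a) (x b)| ≤ ε) :
    |ursellOf (fun P : Finset (Option J) => ∫ z, ∏ l ∈ legs own P, z (x l)
          ∂((gaussianFieldOfKernel K₁).map fun (ζ : S → ℝ) (y : S) => u₁ y + ζ y)) (allV J) -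
        ursellOf (fun P : Finset (Option J) => ∫ z, ∏ l ∈ legs own P, z (x l) ∂(gaussianFieldOfKernel K₀)) (allV J)| ≤
      2 ^ Fintype.card Λ * 2 ^ 2 ^ Fintype.card Λ * (Fintype.card Λ * R ^ Fintype.card Λ * ε) := by
  have h := abs_ursellOf_shift_sub_shift_le own hK₁ hK₀ u₁ (fun _ => 0) x hR hε hu₁R
    (fun l => by simpa using zero_le_one.trans hR) hK₁R hK₀R (fun l => by simpa using huε l) hKε
  rwa [map_add_zero_eq] at h

omit [DecidableEq S] in
/-- The number of set partitions of a finite set is at most `2^{2^{|s|}}` (private copy of the sibling's count). [folklore] -/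
private theorem card_setPartitions_le' {κ : Type} [DecidableEq κ] (s : Finset κ) :
    ((setPartitions s).card : ℝ) ≤ 2 ^ 2 ^ s.card := by
  classical
  have h : (setPartitions s).card ≤ s.powerset.powerset.card := by
    unfold Literature.Probability.LatticeModels.setPartitions
    exact card_filter_le _ _
  rw [card_powerset, card_powerset] at h
  exact_mod_cast h

/-- **A-PRIORI MOMENTS OF MONOMIALS UNDER A SHIFTED KERNEL FIELD** («point 2)» of Appendix C as a moment input, kernel-generic): for a
psd kernel `K` on any index set, a centre `u` and legs `x : κ → S` with `|u(x_l)| ≤ K₀`, `|K(x_a,x_b)| ≤ K₀` (`K₀ ≥ 1`),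
`|∫ Π_{l∈s} z(x_l) d[𝒩(0,K)∘(u+·)⁻¹]| ≤ 2^{2^{|s|}}·K₀^{|s|}` (Wick with a source: each set partition contributes a product of `≤ |s|`
weights `≤ K₀`).  The tree's `…Sect5CondToFree.abs_integral_prod_eval_condField_le` is the conditioned-free-field instance.
[cite: BenfattoEtAl1978, Appendix C 2) p.164 and Appendix D p.165] -/
theorem abs_integral_prod_shift_le {K : S → S → ℝ} (hK : IsPosSemidefKernel K) (u : S → ℝ)
    {κ : Type} [LinearOrder κ] (s : Finset κ) (x : κ → S) {K₀ : ℝ} (hK₀ : 1 ≤ K₀)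
    (hu : ∀ l, |u (x l)| ≤ K₀) (hC : ∀ a b, |K (x a) (x b)| ≤ K₀) :
    |∫ z, ∏ l ∈ s, z (x l) ∂((gaussianFieldOfKernel K).map fun (ζ : S → ℝ) (y : S) => u y + ζ y)| ≤
      2 ^ 2 ^ s.card * K₀ ^ s.card := by
  classical
  rw [integral_prod_shift_eq_sum_setPartitions hK u s x]
  have hblock : ∀ B : Finset κ,
      |(if B.card = 1 then ∏ l ∈ B, u (x l) else pairVal (fun i j => K (x i) (x j)) B)| ≤ K₀ := by
    intro B
    by_cases h1 : B.card = 1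
    · obtain ⟨l, rfl⟩ := card_eq_one.1 h1
      simp only [card_singleton, if_true, prod_singleton]
      exact hu l
    · rw [if_neg h1]
      by_cases h2 : B.card = 2
      · obtain ⟨a, b, hab, rfl⟩ := card_eq_two.1 h2
        rcases lt_or_gt_of_ne hab with h | h
        · rw [pairVal_pair _ h]
          exact hC a b
        · rw [pair_comm, pairVal_pair _ h]
          exact hC b a
      · rw [pairVal_of_card_ne_two _ h2, abs_zero]
        exact zero_le_one.trans hK₀
  have hterm : ∀ τ ∈ setPartitions s,
      |∏ B ∈ τ, (if B.card = 1 then ∏ l ∈ B, u (x l) else pairVal (fun i j => K (x i) (x j)) B)| ≤ K₀ ^ s.card := by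
    intro τ hτ
    have hπ := mem_setPartitions.1 hτ
    rw [Finset.abs_prod]
    calc ∏ B ∈ τ, |(if B.card = 1 then ∏ l ∈ B, u (x l) else pairVal (fun i j => K (x i) (x j)) B)|
        ≤ ∏ _B ∈ τ, K₀ := prod_le_prod (fun B _ => abs_nonneg _) fun B _ => hblock B
      _ = K₀ ^ τ.card := prod_const K₀
      _ ≤ K₀ ^ s.card := pow_le_pow_right₀ hK₀ (card_le_of_isSetPartition hπ)
  refine (abs_sum_le_sum_abs _ _).trans ((sum_le_sum hterm).trans ?_)
  rw [sum_const, nsmul_eq_mul]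
  exact mul_le_mul_of_nonneg_right (card_setPartitions_le' s) (pow_nonneg (zero_le_one.trans hK₀) _)

end TwoShifts

/-! ## §2  The conditioned field of a kernel on the lattice versus the centred field of the kernel -/

section CondKernel

variable {d : ℕ} {K : B1Eq324BenfattoLemma.Site d → B1Eq324BenfattoLemma.Site d → ℝ} (hKp : IsPosSemidefKernel K)
  (C : Finset (B1Eq324BenfattoLemma.Site d)) (hC : IsUnit (covGram K C).det)
variable {J : Type} [Fintype J] [DecidableEq J] {Λ : Type} [Fintype Λ] [LinearOrder Λ] (own : Λ → J)

include hKp hC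

/-- **(5.31)'s «(error)» FOR THE CONDITIONED FIELD OF A KERNEL, TWO CONDITIONING SETS** — covariance conditioned on `C`
(`C^C = condCov K C`, psd by `…KernelRegression.isPosSemidefKernel_condCov`), centre conditioned on `C′` (`u_{C′}(z̄) = condMean K C′ z̄`),
versus the centred field of `K`: if on the legs `|u_{C′}(z̄)(x_l)| ≤ ε`, `|C^C(x_a,x_b) − K(x_a,x_b)| ≤ ε` and a-priori
`|u_{C′}(z̄)|, |C^C|, |K| ≤ R` (`R ≥ 1`), then
`|𝓔^T_{𝒩(0,C^C)∘(u_{C′}(z̄)+·)⁻¹}(z^{A_j}, j∈J) − 𝓔^T_{𝒩(0,K)}(z^{A_j}, j∈J)| ≤ 2^{|Λ|}·2^{2^{|Λ|}}·(|Λ|·R^{|Λ|}·ε)`.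
The shape `C = Q₀∖□` (inside the ambient `Λ`), `C′ = Γ₁` is the plain Dirichlet box Gaussian `N(u_{Γ₁}(ξ)|_□, (A|_□)⁻¹)` of the
temperature-zero (5.13) substitute read on legs inside `□`; `C = C′ = Γ₁` is print's architecture.  The quantitative decay of `ε` in
the distance of the legs from `C` / from `C′` is not derived here ((C.7)/(C.8)-class suppliers named in the module docstring).
[cite: BenfattoEtAl1978, (5.31) p.158 and p.153] -/
theorem abs_ursellOf_condKernel_sub_kernel_le [Nonempty J] (C' : Finset (B1Eq324BenfattoLemma.Site d))
    (zbar : B1Eq324BenfattoLemma.Site d → ℝ) (x : Λ → B1Eq324BenfattoLemma.Site d) {R ε : ℝ} (hR : 1 ≤ R) (hε : 0 ≤ ε)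
    (huR : ∀ l, |condMean K C' zbar (x l)| ≤ R) (hCR : ∀ a b, |condCov K C (x a) (x b)| ≤ R)
    (hKR : ∀ a b, |K (x a) (x b)| ≤ R) (huε : ∀ l, |condMean K C' zbar (x l)| ≤ ε)
    (hCε : ∀ a b, |condCov K C (x a) (x b) - K (x a) (x b)| ≤ ε) :
    |ursellOf (fun P : Finset (Option J) => ∫ z, ∏ l ∈ legs own P, z (x l)
          ∂((gaussianFieldOfKernel (condCov K C)).map
            fun (ζ : B1Eq324BenfattoLemma.Site d → ℝ) (y : B1Eq324BenfattoLemma.Site d) => condMean K C' zbar y + ζ y))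
          (allV J) -
        ursellOf (fun P : Finset (Option J) => ∫ z, ∏ l ∈ legs own P, z (x l) ∂(gaussianFieldOfKernel K)) (allV J)| ≤
      2 ^ Fintype.card Λ * 2 ^ 2 ^ Fintype.card Λ * (Fintype.card Λ * R ^ Fintype.card Λ * ε) :=
  abs_ursellOf_shift_sub_kernel_le own (isPosSemidefKernel_condCov K hKp C hC) hKp (condMean K C' zbar) x hR hε huR hCR
    hKR huε hCε

/-- **(5.31)'s «(error)» FOR `P̄^K_{C,z̄}` VERSUS `𝒩(0,K)`** — the exact kernel twin of
`…Sect5CondToFree.abs_ursellOf_condField_sub_P0_le` (there `K = freeCov d α β`, `P̄ = condField d α β C z̄`, `P̂₀ = P0 d α β`):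
`|𝓔^T_{z̄,C}(z^{A_j}, j∈J) − 𝓔^T_{K,0}(z^{A_j}, j∈J)| ≤ 2^{|Λ|}·2^{2^{|Λ|}}·(|Λ|·R^{|Λ|}·ε)` from `|u_C(z̄)(x_l)| ≤ ε`,
`|C^C(x_a,x_b) − K(x_a,x_b)| ≤ ε` and the a-priori `R ≥ 1` on the legs. [cite: BenfattoEtAl1978, (5.31) p.158 and p.153] -/
theorem abs_ursellOf_condFieldK_sub_kernel_le [Nonempty J] (zbar : B1Eq324BenfattoLemma.Site d → ℝ)
    (x : Λ → B1Eq324BenfattoLemma.Site d) {R ε : ℝ} (hR : 1 ≤ R) (hε : 0 ≤ ε)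
    (huR : ∀ l, |condMean K C zbar (x l)| ≤ R) (hCR : ∀ a b, |condCov K C (x a) (x b)| ≤ R)
    (hKR : ∀ a b, |K (x a) (x b)| ≤ R) (huε : ∀ l, |condMean K C zbar (x l)| ≤ ε)
    (hCε : ∀ a b, |condCov K C (x a) (x b) - K (x a) (x b)| ≤ ε) :
    |ursellOf (fun P : Finset (Option J) => ∫ z, ∏ l ∈ legs own P, z (x l)
          ∂((gaussianFieldOfKernel (condCov K C)).map
            fun (ζ : B1Eq324BenfattoLemma.Site d → ℝ) (y : B1Eq324BenfattoLemma.Site d) => condMean K C zbar y + ζ y))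
          (allV J) -
        ursellOf (fun P : Finset (Option J) => ∫ z, ∏ l ∈ legs own P, z (x l) ∂(gaussianFieldOfKernel K)) (allV J)| ≤
      2 ^ Fintype.card Λ * 2 ^ 2 ^ Fintype.card Λ * (Fintype.card Λ * R ^ Fintype.card Λ * ε) :=
  abs_ursellOf_condKernel_sub_kernel_le hKp C hC own C zbar x hR hε huR hCR hKR huε hCε

omit [Fintype J] [DecidableEq J] [Fintype Λ] [LinearOrder Λ] in
/-- **A-PRIORI MOMENTS OF MONOMIALS UNDER THE TWO-SET CONDITIONED FIELD OF A KERNEL**: `|u_{C′}(z̄)(x_l)| ≤ K₀` and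
`|C^C(x_a,x_b)| ≤ K₀` on the legs (`K₀ ≥ 1`; (C.8)- and (C.6)-class) give `|∫ Π_{l∈s} z(x_l) d[𝒩(0,C^C)∘(u_{C′}(z̄)+·)⁻¹]| ≤ 2^{2^{|s|}}·K₀^{|s|}`
(`abs_integral_prod_shift_le` at `C^C`).  At `C′ = C` and `K = freeCov d α β` this is `…Sect5CondToFree.abs_integral_prod_eval_condField_le`.
[cite: BenfattoEtAl1978, Appendix C 2) p.164 and Appendix D p.165] -/
theorem abs_integral_prod_condKernel_le (C' : Finset (B1Eq324BenfattoLemma.Site d))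
    (zbar : B1Eq324BenfattoLemma.Site d → ℝ) {κ : Type} [LinearOrder κ] (s : Finset κ)
    (x : κ → B1Eq324BenfattoLemma.Site d) {K₀ : ℝ} (hK₀ : 1 ≤ K₀)
    (hu : ∀ l, |condMean K C' zbar (x l)| ≤ K₀) (hCd : ∀ a b, |condCov K C (x a) (x b)| ≤ K₀) :
    |∫ z, ∏ l ∈ s, z (x l) ∂((gaussianFieldOfKernel (condCov K C)).map
        fun (ζ : B1Eq324BenfattoLemma.Site d → ℝ) (y : B1Eq324BenfattoLemma.Site d) => condMean K C' zbar y + ζ y)| ≤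
      2 ^ 2 ^ s.card * K₀ ^ s.card :=
  abs_integral_prod_shift_le (isPosSemidefKernel_condCov K hKp C hC) (condMean K C' zbar) s x hK₀ hu hCd

end CondKernel

end Literature.MathematicalPhysics.QuantumFieldTheory.Balaban1983to89.B1Eq324BenfattoKernelCondToFree
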